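import Literature.AnabelianGeometry.SemiGraphs.FiniteEtaleCoveringDictionary
import Literature.AnabelianGeometry.SemiGraphs.CoveringEstrangedTransfer
import Literature.AnabelianGeometry.SemiGraphs.CoveringElevatedTransfer
import Literature.AnabelianGeometry.SemiGraphs.CoveringQuasiCoherentProofs

/-!
# The finite étale covering dictionary ([SemiAnbd] §2) — PROOFS, part 5: (D5) quasi-coherent, (D6) elevated, (D7) estranged / aloof

Mochizuki, *Semi-graphs of anabelioids*, Publ. RIMS **42** (2006) 221–322, Def. 2.4 (i), (iv)
pp. 25–26, Cor. 2.7 p. 30 [cite: MochizukiSemiAnbd2006, Def. 2.4(iv) p.26].  abc-iut cell, layer L3,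
DISCHARGE-L3 §G row G30 (abc-iut-L4-t17, abc-iut-L6-d5; rulings μ2/π2/ρ2): the dictionary facts
(D5) `covering_isQuasiCoherent`, (D6) `covering_isElevated` and (D7) `covering_isTotallyEstranged` of
`FiniteEtaleCoveringDictionary.lean` (v3) DISCHARGED AS TYPED — one-line wrappers around
abc-iut-L6-d5's `isQuasiCoherent_of_covering` (`CoveringQuasiCoherentProofs`; with (D4)
`covering_isOfInjectiveType_holds` supplying injective type), `isElevated_of_isFiniteEtaleCoveringOf`
(`CoveringElevatedTransfer`, over abc-iut-L6-d5's approximator transport) and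
`covering_isTotallyEstranged_of_isBranchAligned` (`CoveringEstrangedTransfer`); only the LOCAL clause
(and, for D7, branch alignment) is used — the other binders of the dictionary statements are idle.  Nothing here takes a side on [IUTchIII] Cor. 3.12;
typed ≠ discharged.
-/

namespace Literature.AnabelianGeometry.SemiGraphs

namespace SemiGraphOfAnabelioids

universe v₁ u₁ u

/-- **(D5) DISCHARGED**: a finite étale covering of a connected quasi-coherent semi-graph of
anabelioids is quasi-coherent ([SemiAnbd] p. 29 l. −12, p. 30; core by abc-iut-L6-d5, injective type
by (D4)). [cite: MochizukiSemiAnbd2006, Prop. 2.6 p.29] -/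
theorem covering_isQuasiCoherent_holds : covering_isQuasiCoherent.{v₁, u₁, u} :=
  fun 𝒢 𝒢' φ A hc _ hφ _ hq => isQuasiCoherent_of_covering φ A hc hφ hq
    (covering_isOfInjectiveType_holds 𝒢 𝒢' φ A hc hφ hq.isOfInjectiveType)

/-- **(D6) DISCHARGED**: over an elevated vertex, the vertices of a finite étale covering are
elevated ([SemiAnbd] Def. 2.4 (i); Cor. 2.7 p. 30). [cite: MochizukiSemiAnbd2006, Cor. 2.7 p.30] -/
theorem covering_isElevated_holds : covering_isElevated.{v₁, u₁, u} :=
  fun _ _ φ A _ _ hφ _ _ _ v' hv => isElevated_of_isFiniteEtaleCoveringOf φ A hφ v' hv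

/-- **(D7) DISCHARGED**: a branch-aligned finite étale covering of a totally estranged (resp.
totally aloof) semi-graph of anabelioids is totally estranged (resp. totally aloof)
([SemiAnbd] Def. 2.4 (iv)). [cite: MochizukiSemiAnbd2006, Def. 2.4(iv) p.26] -/
theorem covering_isTotallyEstranged_holds : covering_isTotallyEstranged.{v₁, u₁, u} :=
  fun _ _ φ A _ hφ _ hal => covering_isTotallyEstranged_of_isBranchAligned φ A hφ hal

end SemiGraphOfAnabelioids

end Literature.AnabelianGeometry.SemiGraphs
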